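import Mathlib
import Literature.Analysis.FluidPDE.TypeIAncientMild
import Literature.Analysis.FluidPDE.HyperbolicDSSOrbit
import Literature.Analysis.FluidPDE.VorticityCalculus
import Literature.Analysis.FluidPDE.RadialSmoothCutoff
import Summits.NavierStokesRegularity.NavierStokesRegularity.Theorems.SqueezeCycleMustSqueezeAlgebra

/-!
# drefute evidence — the cheap pieces of the lead's skeleton v1 (line `outward-drift-signed-flux`)

Sorry-free proofs of: `stub_simDictionary` part (i) (`‖U‖ ≤ C`), `stub_gradEnergyBasic` parts (i) and
(iii) (nonnegativity, monotonicity in the radius), `stub_divCurlBalls` parts (iii) and (iv)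
(`E(R) ≤ ∫φ_R|∇U|²_F`, `Z_R ↑` in `R`), plus the regularity facts they rest on (slices of the orbit are
smooth; the Frobenius density and the cut-off enstrophy density are continuous, the latter compactly
supported).  For the lead to paste.
-/

noncomputable section

open MeasureTheory Set Filter Real Metric
open scoped ContDiff
open Literature.Analysis.FluidPDE

namespace Drefute

local notation "ℝ³" => EuclideanSpace ℝ (Fin 3)

variable {C : ℝ} {u : ℝ → ℝ³ → ℝ³}

/-- Slices of the similarity orbit of a class element are smooth. -/
theorem contDiff_lerayOrbit_slice (hu : IsTypeIAncientMild C u) (s : ℝ) {n : ℕ∞} :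
    ContDiff ℝ n (lerayOrbit u s) := by
  have h : ContDiff ℝ n (Function.uncurry (lerayOrbit u)) :=
    contDiff_uncurry_lerayOrbit (hu.1.of_le (by exact_mod_cast le_top))
  exact h.comp (contDiff_prodMk_right s)

/-- **stub_simDictionary (i)**: `‖U(s,y)‖ ≤ C` from H4. -/
theorem norm_lerayOrbit_le (hu : IsTypeIAncientMild C u) (s : ℝ) (y : ℝ³) :
    ‖lerayOrbit u s y‖ ≤ C := by
  have hpos : 0 < Real.exp (-s / 2) := Real.exp_pos _
  have key := hu.2.2.2 (-Real.exp (-s)) (by simpa using Real.exp_pos (-s)) (Real.exp (-s / 2) • y)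
  rw [neg_neg, sqrt_exp_neg] at key
  rw [lerayOrbit_apply, norm_smul, Real.norm_of_nonneg hpos.le]
  calc Real.exp (-s / 2) * ‖u (-Real.exp (-s)) (Real.exp (-s / 2) • y)‖
      ≤ Real.exp (-s / 2) * (C / Real.exp (-s / 2)) := by gcongr
    _ = C := by field_simp

/-- The Frobenius gradient density of a slice is continuous. -/
theorem continuous_frobeniusNormSq_fderiv_lerayOrbit (hu : IsTypeIAncientMild C u) (s : ℝ) :
    Continuous fun y => frobeniusNormSq (fderiv ℝ (lerayOrbit u s) y) := by
  have hc : Continuous (fderiv ℝ (lerayOrbit u s)) :=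
    (contDiff_lerayOrbit_slice hu s (n := 1)).continuous_fderiv one_ne_zero
  unfold frobeniusNormSq
  exact continuous_finsetSum _ fun i _ => ((hc.clm_apply continuous_const).norm).pow 2

/-- The vorticity density of a slice is continuous. -/
theorem continuous_norm_lerayVorticity_sq (hu : IsTypeIAncientMild C u) (s : ℝ) :
    Continuous fun y => ‖lerayVorticity u s y‖ ^ 2 := by
  rw [lerayVorticity_apply]
  exact ((continuous_curl (contDiff_lerayOrbit_slice hu s (n := 1))).norm).pow 2

/-- **stub_gradEnergyBasic (i)**: `0 ≤ E(ρ, s)`. -/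
theorem ballGradEnergy_nonneg (u : ℝ → ℝ³ → ℝ³) (ρ s : ℝ) :
    0 ≤ ∫ y in ball (0 : ℝ³) ρ, frobeniusNormSq (fderiv ℝ (lerayOrbit u s) y) :=
  setIntegral_nonneg measurableSet_ball fun _ _ => frobeniusNormSq_nonneg _

/-- Integrability of the Frobenius density on balls. -/
theorem integrableOn_frobeniusNormSq_ball (hu : IsTypeIAncientMild C u) (s ρ : ℝ) :
    IntegrableOn (fun y => frobeniusNormSq (fderiv ℝ (lerayOrbit u s) y)) (ball (0 : ℝ³) ρ) :=
  (((continuous_frobeniusNormSq_fderiv_lerayOrbit hu s).continuousOn).integrableOn_compact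
    (isCompact_closedBall (0 : ℝ³) ρ)).mono_set ball_subset_closedBall

/-- **stub_gradEnergyBasic (iii)**: monotonicity of `E(ρ, s)` in `ρ`. -/
theorem ballGradEnergy_mono (hu : IsTypeIAncientMild C u) (s ρ ρ' : ℝ) (hρρ' : ρ ≤ ρ') :
    (∫ y in ball (0 : ℝ³) ρ, frobeniusNormSq (fderiv ℝ (lerayOrbit u s) y)) ≤
      ∫ y in ball (0 : ℝ³) ρ', frobeniusNormSq (fderiv ℝ (lerayOrbit u s) y) :=
  setIntegral_mono_set (integrableOn_frobeniusNormSq_ball hu s ρ')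
    (Eventually.of_forall fun _ => frobeniusNormSq_nonneg _)
    (Eventually.of_forall (ball_subset_ball hρρ'))

/-- The cut-off Frobenius density is integrable (compact support). -/
theorem integrable_cutoff_mul_frobeniusNormSq (hu : IsTypeIAncientMild C u) (s : ℝ) {R : ℝ} (hR : 0 < R) :
    Integrable fun y : ℝ³ => smoothTransition (2 - ‖y‖ ^ 2 / R ^ 2) *
      frobeniusNormSq (fderiv ℝ (lerayOrbit u s) y) :=
  (((contDiff_smoothTransition_cutoff (n := 0) R).continuous).mul
    (continuous_frobeniusNormSq_fderiv_lerayOrbit hu s)).integrable_of_hasCompactSupport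
    ((hasCompactSupport_smoothTransition_cutoff hR).mul_right)

/-- The cut-off enstrophy density is integrable (compact support). -/
theorem integrable_cutoff_mul_vorticity (hu : IsTypeIAncientMild C u) (s : ℝ) {R : ℝ} (hR : 0 < R) :
    Integrable fun y : ℝ³ => smoothTransition (2 - ‖y‖ ^ 2 / R ^ 2) * ‖lerayVorticity u s y‖ ^ 2 :=
  (((contDiff_smoothTransition_cutoff (n := 0) R).continuous).mul
    (continuous_norm_lerayVorticity_sq hu s)).integrable_of_hasCompactSupport
    ((hasCompactSupport_smoothTransition_cutoff hR).mul_right)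

/-- **stub_divCurlBalls (iii)**: `E(R) ≤ ∫ φ_R |∇U|²_F` (`φ_R = 1` on `B_R`, integrand `≥ 0`). -/
theorem ballGradEnergy_le_cutoff (hu : IsTypeIAncientMild C u) (s : ℝ) {R : ℝ} (hR : 0 < R) :
    (∫ y in ball (0 : ℝ³) R, frobeniusNormSq (fderiv ℝ (lerayOrbit u s) y)) ≤
      ∫ y, smoothTransition (2 - ‖y‖ ^ 2 / R ^ 2) * frobeniusNormSq (fderiv ℝ (lerayOrbit u s) y) := by
  have hint := integrable_cutoff_mul_frobeniusNormSq hu s hR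
  calc (∫ y in ball (0 : ℝ³) R, frobeniusNormSq (fderiv ℝ (lerayOrbit u s) y))
      = ∫ y in ball (0 : ℝ³) R, smoothTransition (2 - ‖y‖ ^ 2 / R ^ 2) *
          frobeniusNormSq (fderiv ℝ (lerayOrbit u s) y) := by
        refine setIntegral_congr_fun measurableSet_ball fun y hy => ?_
        rw [mem_ball, dist_zero_right] at hy
        rw [smoothTransition_cutoff_eq_one hR hy.le, one_mul]
    _ ≤ ∫ y, smoothTransition (2 - ‖y‖ ^ 2 / R ^ 2) * frobeniusNormSq (fderiv ℝ (lerayOrbit u s) y) :=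
        setIntegral_le_integral hint (Eventually.of_forall fun y =>
          mul_nonneg (smoothTransition_cutoff_nonneg R y) (frobeniusNormSq_nonneg _))

/-- **stub_divCurlBalls (iv)**: `Z_R ≤ Z_{R'}` for `0 < R ≤ R'` (the cutoffs are ordered). -/
theorem cutoffEnstrophy_mono (hu : IsTypeIAncientMild C u) (s : ℝ) {R R' : ℝ} (hR : 0 < R) (hRR' : R ≤ R') :
    (∫ y, smoothTransition (2 - ‖y‖ ^ 2 / R ^ 2) * ‖lerayVorticity u s y‖ ^ 2) ≤
      ∫ y, smoothTransition (2 - ‖y‖ ^ 2 / R' ^ 2) * ‖lerayVorticity u s y‖ ^ 2 := by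
  have hR' : 0 < R' := lt_of_lt_of_le hR hRR'
  refine integral_mono (integrable_cutoff_mul_vorticity hu s hR) (integrable_cutoff_mul_vorticity hu s hR')
    fun y => ?_
  refine mul_le_mul_of_nonneg_right (Real.smoothTransition.monotone ?_) (sq_nonneg _)
  have h : ‖y‖ ^ 2 / R' ^ 2 ≤ ‖y‖ ^ 2 / R ^ 2 :=
    div_le_div_of_nonneg_left (sq_nonneg _) (by positivity) (pow_le_pow_left₀ hR.le hRR' 2)
  linarith

/-- The Frobenius gradient density is jointly continuous in `(s, y)`. -/
theorem continuous_frobeniusNormSq_fderiv_lerayOrbit_uncurry (hu : IsTypeIAncientMild C u) :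
    Continuous fun p : ℝ × ℝ³ => frobeniusNormSq (fderiv ℝ (lerayOrbit u p.1) p.2) := by
  have hU : ContDiff ℝ ∞ (Function.uncurry (lerayOrbit u)) := contDiff_uncurry_lerayOrbit hu.1
  have hU' : ContDiff ℝ ∞ (Function.uncurry fun (p : ℝ × ℝ³) (q : ℝ³) => lerayOrbit u p.1 q) := by
    have e : (Function.uncurry fun (p : ℝ × ℝ³) (q : ℝ³) => lerayOrbit u p.1 q) =
        Function.uncurry (lerayOrbit u) ∘ fun r : (ℝ × ℝ³) × ℝ³ => (r.1.1, r.2) := by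
      funext r; rfl
    rw [e]
    exact hU.comp ((contDiff_fst.comp contDiff_fst).prodMk contDiff_snd)
  have hD : ContDiff ℝ ∞ fun p : ℝ × ℝ³ => fderiv ℝ (lerayOrbit u p.1) p.2 :=
    hU'.fderiv (m := ∞) (n := ∞) contDiff_snd (by simp)
  have hc : Continuous fun p : ℝ × ℝ³ => fderiv ℝ (lerayOrbit u p.1) p.2 := hD.continuous
  unfold frobeniusNormSq
  exact continuous_finsetSum _ fun i _ => ((hc.clm_apply continuous_const).norm).pow 2

/-- `B_ρ` and its closure agree up to a null set (the sphere is Lebesgue-null). -/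
theorem ball_ae_eq_closedBall' (ρ : ℝ) :
    (ball (0 : ℝ³) ρ : Set ℝ³) =ᵐ[volume] (closedBall (0 : ℝ³) ρ : Set ℝ³) := by
  rw [← ball_union_sphere]
  exact (union_ae_eq_left_of_ae_eq_empty (ae_eq_empty.2 (Measure.addHaar_sphere volume _ _))).symm

/-- **stub_gradEnergyBasic (ii)**: continuity of `s ↦ E(ρ, s)`. -/
theorem continuous_ballGradEnergy (hu : IsTypeIAncientMild C u) (ρ : ℝ) :
    Continuous fun s => ∫ y in ball (0 : ℝ³) ρ, frobeniusNormSq (fderiv ℝ (lerayOrbit u s) y) := by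
  have e : (fun s => ∫ y in ball (0 : ℝ³) ρ, frobeniusNormSq (fderiv ℝ (lerayOrbit u s) y)) =
      fun s => ∫ y in closedBall (0 : ℝ³) ρ, frobeniusNormSq (fderiv ℝ (lerayOrbit u s) y) := by
    funext s
    exact setIntegral_congr_set (ball_ae_eq_closedBall' ρ)
  rw [e]
  exact continuous_parametric_integral_of_continuous
    (f := fun s y => frobeniusNormSq (fderiv ℝ (lerayOrbit u s) y))
    (continuous_frobeniusNormSq_fderiv_lerayOrbit_uncurry hu) (isCompact_closedBall _ _)

/-- **stub_gradEnergyBasic**, verbatim signature of the lead's stub, proved. -/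
theorem stub_gradEnergyBasic : ∀ (C : ℝ) (u : ℝ → ℝ³ → ℝ³), IsTypeIAncientMild C u →
    (∀ (ρ s : ℝ), 0 < ρ →
      0 ≤ ∫ y in Metric.ball (0 : ℝ³) ρ, frobeniusNormSq (fderiv ℝ (lerayOrbit u s) y)) ∧
    (∀ ρ : ℝ, 0 < ρ →
      Continuous fun s => ∫ y in Metric.ball (0 : ℝ³) ρ, frobeniusNormSq (fderiv ℝ (lerayOrbit u s) y)) ∧
    (∀ (s ρ ρ' : ℝ), 0 < ρ → ρ ≤ ρ' →
      ∫ y in Metric.ball (0 : ℝ³) ρ, frobeniusNormSq (fderiv ℝ (lerayOrbit u s) y) ≤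
        ∫ y in Metric.ball (0 : ℝ³) ρ', frobeniusNormSq (fderiv ℝ (lerayOrbit u s) y)) :=
  fun _C u hu => ⟨fun ρ s _ => ballGradEnergy_nonneg u ρ s, fun ρ _ => continuous_ballGradEnergy hu ρ,
    fun s ρ ρ' _ h => ballGradEnergy_mono hu s ρ ρ' h⟩

/-! ## `stub_divCurlBalls` (i): `Z_R ≤ 6 E(2R)` -/

/-- Pointwise: `|curl v|² ≤ 2 |∇v|²_F` (`|ω|² = |A|²_F − tr A²` and `|A|²_F + tr A² = ½ Σ (Aᵢⱼ + Aⱼᵢ)² ≥ 0`). -/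
theorem norm_curl_sq_le_two_mul_frobeniusNormSq (v : ℝ³ → ℝ³) (y : ℝ³) :
    ‖curl v y‖ ^ 2 ≤ 2 * frobeniusNormSq (fderiv ℝ v y) := by
  rw [Summit.NavierStokesRegularity.NavierStokesRegularity.Theorems.norm_curl_sq_eq_frobeniusNormSq_sub_trace]
  have htr : LinearMap.trace ℝ ℝ³ ((fderiv ℝ v y : ℝ³ →ₗ[ℝ] ℝ³) ∘ₗ (fderiv ℝ v y : ℝ³ →ₗ[ℝ] ℝ³)) =
      (stdMatrix (fderiv ℝ v y : ℝ³ →ₗ[ℝ] ℝ³) * stdMatrix (fderiv ℝ v y : ℝ³ →ₗ[ℝ] ℝ³)).trace := by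
    rw [← trace_stdMatrix, stdMatrix_comp]
  rw [htr, frobeniusNormSq_eq_sum_sq_stdMatrix]
  set M := stdMatrix (fderiv ℝ v y : ℝ³ →ₗ[ℝ] ℝ³)
  simp only [Matrix.trace, Matrix.diag, Matrix.mul_apply, Fin.sum_univ_three]
  nlinarith [sq_nonneg (M 0 1 + M 1 0), sq_nonneg (M 0 2 + M 2 0), sq_nonneg (M 1 2 + M 2 1),
    sq_nonneg (M 0 0), sq_nonneg (M 1 1), sq_nonneg (M 2 2)]

/-- **stub_divCurlBalls (i)**: `Z_R ≤ 6 E(2R)` (in fact `≤ 2 E(2R)`). -/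
theorem cutoffEnstrophy_le_six_ballGradEnergy (hu : IsTypeIAncientMild C u) (s : ℝ) {R : ℝ} (hR : 0 < R) :
    (∫ y, smoothTransition (2 - ‖y‖ ^ 2 / R ^ 2) * ‖lerayVorticity u s y‖ ^ 2) ≤
      6 * ∫ y in ball (0 : ℝ³) (2 * R), frobeniusNormSq (fderiv ℝ (lerayOrbit u s) y) := by
  have hf0 : ∀ y, 0 ≤ frobeniusNormSq (fderiv ℝ (lerayOrbit u s) y) := fun y => frobeniusNormSq_nonneg _
  have hφ0 : ∀ y : ℝ³, 0 ≤ smoothTransition (2 - ‖y‖ ^ 2 / R ^ 2) := fun y =>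
    smoothTransition_cutoff_nonneg R y
  have hφ1 : ∀ y : ℝ³, smoothTransition (2 - ‖y‖ ^ 2 / R ^ 2) ≤ 1 := fun y =>
    smoothTransition_cutoff_le_one R y
  have hI2 : Integrable fun y : ℝ³ => smoothTransition (2 - ‖y‖ ^ 2 / R ^ 2) *
      (2 * frobeniusNormSq (fderiv ℝ (lerayOrbit u s) y)) := by
    refine ((integrable_cutoff_mul_frobeniusNormSq hu s hR).const_mul 2).congr ?_
    filter_upwards with y
    ring
  -- step 1: pointwise `φ |Ω|² ≤ φ · 2 |∇U|²_F`
  have h1 : (∫ y, smoothTransition (2 - ‖y‖ ^ 2 / R ^ 2) * ‖lerayVorticity u s y‖ ^ 2) ≤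
      ∫ y, smoothTransition (2 - ‖y‖ ^ 2 / R ^ 2) * (2 * frobeniusNormSq (fderiv ℝ (lerayOrbit u s) y)) := by
    refine integral_mono (integrable_cutoff_mul_vorticity hu s hR) hI2 fun y => ?_
    refine mul_le_mul_of_nonneg_left ?_ (hφ0 y)
    rw [lerayVorticity_apply]
    exact norm_curl_sq_le_two_mul_frobeniusNormSq _ _
  -- step 2: the integrand vanishes off `closedBall 0 (2R)`
  have h2 : (∫ y, smoothTransition (2 - ‖y‖ ^ 2 / R ^ 2) * (2 * frobeniusNormSq (fderiv ℝ (lerayOrbit u s) y))) =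
      ∫ y in closedBall (0 : ℝ³) (2 * R),
        smoothTransition (2 - ‖y‖ ^ 2 / R ^ 2) * (2 * frobeniusNormSq (fderiv ℝ (lerayOrbit u s) y)) := by
    refine (setIntegral_eq_integral_of_forall_compl_eq_zero fun y hy => ?_).symm
    rw [smoothTransition_cutoff_eq_zero_of_notMem hR hy, zero_mul]
  -- step 3: `φ ≤ 1` on the closed ball
  have hfi : IntegrableOn (fun y => 2 * frobeniusNormSq (fderiv ℝ (lerayOrbit u s) y)) (closedBall (0 : ℝ³) (2 * R)) :=
    ((continuous_const.mul (continuous_frobeniusNormSq_fderiv_lerayOrbit hu s)).continuousOn).integrableOn_compact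
      (isCompact_closedBall _ _)
  have h3 : (∫ y in closedBall (0 : ℝ³) (2 * R),
        smoothTransition (2 - ‖y‖ ^ 2 / R ^ 2) * (2 * frobeniusNormSq (fderiv ℝ (lerayOrbit u s) y))) ≤
      ∫ y in closedBall (0 : ℝ³) (2 * R), 2 * frobeniusNormSq (fderiv ℝ (lerayOrbit u s) y) := by
    refine setIntegral_mono_on hI2.integrableOn hfi measurableSet_closedBall fun y _ => ?_
    have h2f : 0 ≤ 2 * frobeniusNormSq (fderiv ℝ (lerayOrbit u s) y) := mul_nonneg zero_le_two (hf0 y)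
    have := mul_le_mul_of_nonneg_right (hφ1 y) h2f
    linarith
  -- step 4: closed ball = open ball a.e.
  have h4 : (∫ y in closedBall (0 : ℝ³) (2 * R), 2 * frobeniusNormSq (fderiv ℝ (lerayOrbit u s) y)) =
      2 * ∫ y in ball (0 : ℝ³) (2 * R), frobeniusNormSq (fderiv ℝ (lerayOrbit u s) y) := by
    rw [integral_const_mul, setIntegral_congr_set (ball_ae_eq_closedBall' (2 * R))]
  have h5 : 0 ≤ ∫ y in ball (0 : ℝ³) (2 * R), frobeniusNormSq (fderiv ℝ (lerayOrbit u s) y) :=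
    ballGradEnergy_nonneg u (2 * R) s
  linarith

/-! ## `stub_endgame`: vanishing ball gradient energies + Morrey ⇒ `u ≡ 0` -/

/-- A map of `ℝ³` with zero Frobenius norm is zero. -/
theorem eq_zero_of_frobeniusNormSq_eq_zero {L : ℝ³ →L[ℝ] ℝ³} (h : frobeniusNormSq L = 0) : L = 0 := by
  unfold frobeniusNormSq at h
  have h' := (Finset.sum_eq_zero_iff_of_nonneg (fun i _ => sq_nonneg _)).1 h
  have hb : ∀ i, L (stdOrthonormalBasis ℝ ℝ³ i) = 0 := fun i => by
    have := h' i (Finset.mem_univ i)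
    rwa [sq_eq_zero_iff, norm_eq_zero] at this
  have hlin : (L : ℝ³ →ₗ[ℝ] ℝ³) = ((0 : ℝ³ →L[ℝ] ℝ³) : ℝ³ →ₗ[ℝ] ℝ³) :=
    (stdOrthonormalBasis ℝ ℝ³).toBasis.ext fun i => by
      rw [OrthonormalBasis.coe_toBasis, ContinuousLinearMap.coe_coe, hb i]
      rfl
  exact ContinuousLinearMap.coe_injective hlin

/-- Step A: if every ball gradient energy of the orbit vanishes, every slice has zero derivative. -/
theorem fderiv_lerayOrbit_eq_zero (hu : IsTypeIAncientMild C u)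
    (hE : ∀ (ρ s : ℝ), 0 < ρ →
      ∫ y in ball (0 : ℝ³) ρ, frobeniusNormSq (fderiv ℝ (lerayOrbit u s) y) = 0)
    (s : ℝ) (y : ℝ³) : fderiv ℝ (lerayOrbit u s) y = 0 := by
  by_contra hne
  have hpos : 0 < frobeniusNormSq (fderiv ℝ (lerayOrbit u s) y) :=
    lt_of_le_of_ne (frobeniusNormSq_nonneg _)
      (fun h => hne (eq_zero_of_frobeniusNormSq_eq_zero h.symm))
  set ρ : ℝ := ‖y‖ + 1 with hρ
  have hρ0 : 0 < ρ := by rw [hρ]; positivity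
  have hy : y ∈ ball (0 : ℝ³) ρ := by rw [mem_ball, dist_zero_right, hρ]; linarith
  have hsupp : IsOpen (Function.support fun z => frobeniusNormSq (fderiv ℝ (lerayOrbit u s) z)) :=
    (continuous_frobeniusNormSq_fderiv_lerayOrbit hu s).isOpen_support
  have hμ : 0 < volume ((Function.support fun z => frobeniusNormSq (fderiv ℝ (lerayOrbit u s) z)) ∩
      ball (0 : ℝ³) ρ) :=
    (hsupp.inter isOpen_ball).measure_pos volume ⟨y, Function.mem_support.2 hpos.ne', hy⟩
  have hint : 0 < ∫ z in ball (0 : ℝ³) ρ, frobeniusNormSq (fderiv ℝ (lerayOrbit u s) z) :=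
    (setIntegral_pos_iff_support_of_nonneg_ae (Eventually.of_forall fun _ => frobeniusNormSq_nonneg _)
      (integrableOn_frobeniusNormSq_ball hu s ρ)).2 hμ
  linarith [hE ρ s hρ0]

/-- Step B–C: with the Morrey bound, every slice of the orbit vanishes identically. -/
theorem lerayOrbit_eq_zero (hu : IsTypeIAncientMild C u)
    (hM : ∀ (s : ℝ) (y₀ : ℝ³) (ρ : ℝ), 0 < ρ → ∫ y in ball y₀ ρ, ‖lerayOrbit u s y‖ ^ 2 ≤ C * ρ)
    (hE : ∀ (ρ s : ℝ), 0 < ρ →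
      ∫ y in ball (0 : ℝ³) ρ, frobeniusNormSq (fderiv ℝ (lerayOrbit u s) y) = 0)
    (s : ℝ) (y : ℝ³) : lerayOrbit u s y = 0 := by
  -- the slice is constant
  have hd : Differentiable ℝ (lerayOrbit u s) := (contDiff_lerayOrbit_slice hu s (n := 1)).differentiable
    one_ne_zero
  have hconst : ∀ z, lerayOrbit u s z = lerayOrbit u s y := fun z =>
    is_const_of_fderiv_eq_zero hd (fderiv_lerayOrbit_eq_zero hu hE s) z y
  set c : ℝ³ := lerayOrbit u s y with hc
  -- the Morrey bound on balls about `0`: `‖c‖² · (4π/3) ρ³ ≤ C ρ`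
  have hball : ∀ ρ : ℝ, 0 < ρ → ‖c‖ ^ 2 * (ρ ^ 3 * (π * 4 / 3)) ≤ C * ρ := by
    intro ρ hρ
    have h := hM s 0 ρ hρ
    have e : (∫ z in ball (0 : ℝ³) ρ, ‖lerayOrbit u s z‖ ^ 2) = ∫ _z in ball (0 : ℝ³) ρ, ‖c‖ ^ 2 :=
      setIntegral_congr_fun measurableSet_ball fun z _ => by rw [hconst z]
    rw [e, setIntegral_const, smul_eq_mul, measureReal_def, EuclideanSpace.volume_ball_fin_three,
      ENNReal.toReal_mul, ENNReal.toReal_pow, ENNReal.toReal_ofReal hρ.le,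
      ENNReal.toReal_ofReal (by positivity)] at h
    linarith
  -- hence `c = 0`
  have hC : 0 ≤ C := by
    have h := hball 1 one_pos
    nlinarith [sq_nonneg ‖c‖, Real.pi_pos]
  by_contra hne
  have hcpos : 0 < ‖c‖ ^ 2 := by positivity
  set k : ℝ := ‖c‖ ^ 2 * (π * 4 / 3) with hk
  have hkpos : 0 < k := by rw [hk]; positivity
  set ρ : ℝ := C / k + 1 with hρ
  have hρ1 : 1 ≤ ρ := by rw [hρ]; linarith [div_nonneg hC hkpos.le]
  have hρ0 : 0 < ρ := by linarith
  have h := hball ρ hρ0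
  -- `k ρ³ ≤ C ρ` with `ρ ≥ 1` gives `k ρ ≤ C`, but `k ρ = C + k > C`
  have h1 : k * ρ ^ 3 ≤ C * ρ := by rw [hk]; nlinarith [h]
  have h2a : k * ρ ^ 2 ≤ C := by
    by_contra hlt
    rw [not_le] at hlt
    have := mul_lt_mul_of_pos_left hlt hρ0
    nlinarith [this, h1]
  have h2 : k * ρ ≤ C := by
    have hmono : k * ρ ≤ k * ρ ^ 2 := by
      have : 0 ≤ k * ρ * (ρ - 1) := mul_nonneg (mul_nonneg hkpos.le hρ0.le) (by linarith)
      nlinarith [this]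
    exact hmono.trans h2a
  have h3 : k * ρ = C + k := by rw [hρ]; field_simp
  linarith

/-- **stub_endgame**, verbatim signature of the lead's stub, proved. -/
theorem stub_endgame : ∀ (C : ℝ) (u : ℝ → ℝ³ → ℝ³), IsTypeIAncientMild C u →
    (∀ (s : ℝ) (y₀ : ℝ³) (ρ : ℝ), 0 < ρ →
      ∫ y in Metric.ball y₀ ρ, ‖lerayOrbit u s y‖ ^ 2 ≤ C * ρ) →
    (∀ (ρ s : ℝ), 0 < ρ →
      ∫ y in Metric.ball (0 : ℝ³) ρ, frobeniusNormSq (fderiv ℝ (lerayOrbit u s) y) = 0) →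
    ∀ t < 0, ∀ x, u t x = 0 := by
  intro C u hu hM hE t ht x
  rw [eq_lerayOrbit_of_neg u ht x, lerayOrbit_eq_zero hu hM hE, smul_zero]

/-! ## `stub_simDictionary` (ii): the Morrey bound in similarity variables -/

/-- **stub_simDictionary (ii)**: `∫_{B_ρ(y₀)} |U(s)|² ≤ C ρ` from H5a by the scaling `x = e^{-s/2} y`. -/
theorem morrey_lerayOrbit (u : ℝ → ℝ³ → ℝ³) {C : ℝ}
    (h5 : ∀ (x₀ : EuclideanSpace ℝ (Fin 3)) (t₀ r : ℝ), t₀ ≤ 0 → 0 < r →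
      (∀ t, t₀ - r^2 < t → t < t₀ → r⁻¹ * ∫ x in Metric.ball x₀ r, ‖u t x‖^2 ≤ C) ∧
      r⁻¹ * ∫ t in Set.Ioo (t₀ - r^2) t₀, ∫ x in Metric.ball x₀ r, ‖fderiv ℝ (u t) x‖^2 ≤ C)
    (s : ℝ) (y₀ : ℝ³) {ρ : ℝ} (hρ : 0 < ρ) :
    ∫ y in ball y₀ ρ, ‖lerayOrbit u s y‖ ^ 2 ≤ C * ρ := by
  set c : ℝ := Real.exp (-s / 2) with hc
  set t : ℝ := -Real.exp (-s) with ht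
  have hcpos : 0 < c := Real.exp_pos _
  have htneg : t < 0 := by rw [ht]; exact neg_neg_of_pos (Real.exp_pos _)
  set r : ℝ := c * ρ with hr
  have hrpos : 0 < r := mul_pos hcpos hρ
  -- the integrand: `‖U(s,y)‖² = c² ‖u t (c y)‖²`
  have e1 : (∫ y in ball y₀ ρ, ‖lerayOrbit u s y‖ ^ 2) =
      c ^ 2 * ∫ y in ball y₀ ρ, (fun x => ‖u t x‖ ^ 2) (c • y) := by
    rw [← integral_const_mul]
    refine setIntegral_congr_fun measurableSet_ball fun y _ => ?_
    rw [lerayOrbit_apply, norm_smul, Real.norm_of_nonneg hcpos.le, mul_pow]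
  -- change of variables `x = c y`
  have e2 : (∫ y in ball y₀ ρ, (fun x => ‖u t x‖ ^ 2) (c • y)) =
      (c ^ 3)⁻¹ * ∫ x in ball (c • y₀) r, ‖u t x‖ ^ 2 := by
    rw [Measure.setIntegral_comp_smul_of_pos volume (fun x => ‖u t x‖ ^ 2) (ball y₀ ρ) hcpos,
      smul_eq_mul, finrank_euclideanSpace_fin, smul_ball hcpos.ne' y₀ ρ, Real.norm_of_nonneg hcpos.le]
  -- H5a on the cylinder with top `t₀ = min 0 (t + r²/2)`
  set t₀ : ℝ := min 0 (t + r ^ 2 / 2) with ht₀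
  have ht₀le : t₀ ≤ 0 := min_le_left _ _
  have hlt : t < t₀ := lt_min htneg (by nlinarith [sq_pos_of_pos hrpos])
  have hgt : t₀ - r ^ 2 < t := by
    have : t₀ ≤ t + r ^ 2 / 2 := min_le_right _ _
    nlinarith [sq_pos_of_pos hrpos]
  have hA := (h5 (c • y₀) t₀ r ht₀le hrpos).1 t hgt hlt
  have hI : (∫ x in ball (c • y₀) r, ‖u t x‖ ^ 2) ≤ r * C := (inv_mul_le_iff₀ hrpos).1 hA
  rw [e1, e2]
  have hcoef : 0 ≤ c ^ 2 * (c ^ 3)⁻¹ := by positivity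
  calc c ^ 2 * ((c ^ 3)⁻¹ * ∫ x in ball (c • y₀) r, ‖u t x‖ ^ 2)
      = c ^ 2 * (c ^ 3)⁻¹ * ∫ x in ball (c • y₀) r, ‖u t x‖ ^ 2 := by ring
    _ ≤ c ^ 2 * (c ^ 3)⁻¹ * (r * C) := mul_le_mul_of_nonneg_left hI hcoef
    _ = C * ρ := by rw [hr]; field_simp

/-- **stub_simDictionary**, verbatim signature of the lead's stub, proved. -/
theorem stub_simDictionary : ∀ (C : ℝ) (u : ℝ → ℝ³ → ℝ³), IsTypeIAncientMild C u →
    (∀ (x₀ : EuclideanSpace ℝ (Fin 3)) (t₀ r : ℝ), t₀ ≤ 0 → 0 < r →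
      (∀ t, t₀ - r^2 < t → t < t₀ → r⁻¹ * ∫ x in Metric.ball x₀ r, ‖u t x‖^2 ≤ C) ∧
      r⁻¹ * ∫ t in Set.Ioo (t₀ - r^2) t₀, ∫ x in Metric.ball x₀ r, ‖fderiv ℝ (u t) x‖^2 ≤ C) →
    (∀ (s : ℝ) (y : ℝ³), ‖lerayOrbit u s y‖ ≤ C) ∧
    (∀ (s : ℝ) (y₀ : ℝ³) (ρ : ℝ), 0 < ρ →
      ∫ y in Metric.ball y₀ ρ, ‖lerayOrbit u s y‖ ^ 2 ≤ C * ρ) :=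
  fun _C u hu h5 => ⟨fun s y => norm_lerayOrbit_le hu s y, fun s y₀ _ρ hρ => morrey_lerayOrbit u h5 s y₀ hρ⟩

end Drefute
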